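import Mathlib
import Summits.Ventures.PercRepro2.TypedPendantA3
import Summits.Ventures.PercRepro2.TypedCoincidence
import Summits.Ventures.PercRepro2.TypedSpectator
import Summits.Ventures.PercRepro2.TypedTwoEdgeOStates

/-!
# The pendant `a₃` at `o`: `N_k = C(2, k) · N₀` (blind cell PercRepro2, mine-2 g54, 2026-08-29;
`conjectures/MINE-2.md` M2-112 / M2-114)

For the kernel `K₃` of the covariance form (HCOV) (`HCovCubic.lean`, state form `KB` of
`OneTypedEdge.lean`), a typed edge `f = {a₃, o}` whose end `a₃` is a leaf carrying exactly the
mark `a₃` — the pendant `a₃` of `TypedPendantA3.lean` attached at the mark `o` — IS a reduction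
rule: the typed base with `f` of class `k` is `C(2, k)` times the base with `a₃` isolated,

  **`typedCount_pendant_a3_at_o`**: `N_{τ[f:=k]} = C(2, k) · N_{τ[f:=0]}`

(`(N₀, N₁, N₂, N₃) = (N₀, 2N₀, N₀, 0)`; an unmarked leaf contributes `C(3, k)`, a pendant `o` or
`b` contributes `C(2, k − 1)`, `TypedPendant.lean`).  Mechanism: closing `f` in a copy isolates
`a₃` there (`st_update_pendant_a3`), opening it makes `o` carry the side data of `a₃` in that copy
(`st_coinc_of_open`, so `1_PD = 1_Q · 1_{o ∉ U}` there, `pdB_coinc`); on the eight placements the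
kernel reduces, modulo the per-copy relations `1_Q 1_{o∉U} u_o = 0` (an inert copy), `σ_o u_o = σ_o`
and the REALISATION relation `1_Q 1_{o∉U} = 1_Q (1 − u_o)` (under `Q` the mark `o` is in at most one
root cluster, `st_real`), to `C(2, k)` times the all-isolated kernel plus a RELABELING kernel `D`
(`KB_pendant_a3_at_o_one`, `KB_pendant_a3_at_o_two`; class `3` is the `o = a₃` coincidence
`KB_eq_zero_of_o_eq_a3`), whose typed count vanishes by the copy swaps (`typedCount_DK`).  So the
rule is a symmetry of the typed count, not a pointwise identity (M2-112 (2)).  Consequence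
(`typedCount_nonneg_pendant_a3_at_o`): row 2′TRI on the instance reduces to the `a₃`-inactive base.
Own work; standard axioms.
-/

namespace Summit.Ventures.PercRepro2

namespace CovForm

namespace TypedRed

open OneTyped

/-! ## States: the coincident copy, the realisation relation and the relabeling kernel -/

section States

/-- On a coincident state (`o` carries the side data of `a₃`), `1_PD = 1_Q · 1_{o ∉ U}`
(`1_{o ∉ U} = [¬(Lo ∨ Ho)]`, written out: no new definition). -/
lemma pdB_coinc (s : St) (h : s.Lo = s.L3 ∧ s.Ho = s.H3) :
    pdB s = qB s * (if s.Lo || s.Ho then 0 else 1) := by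
  obtain ⟨q, lo, ho, lb, hb, l3, h3⟩ := s
  simp only [St.Lo, St.Ho, St.L3, St.H3] at h
  obtain ⟨rfl, rfl⟩ := h
  cases q <;> cases lo <;> cases ho <;> simp [pdB, qB, St.q', St.Lo, St.Ho, St.L3, St.H3]

/-- `1_Q · 1_{o ∉ U} · u_o = 0` (the inert copy). -/
lemma qB_mul_nB_mul_uB (s : St) : qB s * (if s.Lo || s.Ho then 0 else 1) * uB s.Lo s.Ho = 0 := by
  obtain ⟨q, lo, ho, lb, hb, l3, h3⟩ := s
  cases q <;> cases lo <;> cases ho <;> simp [qB, uB, St.q', St.Lo, St.Ho]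

/-- On a REALISED state (under `Q` the mark `o` is in at most one root cluster),
`1_Q · 1_{o ∉ U} = 1_Q · (1 − u_o)`. -/
lemma qB_mul_nB_of_real (s : St) (h : s.q' = false → ¬ (s.Lo = true ∧ s.Ho = true)) :
    qB s * (if s.Lo || s.Ho then 0 else 1) = qB s * (1 - uB s.Lo s.Ho) := by
  obtain ⟨q, lo, ho, lb, hb, l3, h3⟩ := s
  simp only [St.q', St.Lo, St.Ho] at h
  cases q <;> cases lo <;> cases ho <;> simp [qB, uB, St.q', St.Lo, St.Ho] at h ⊢

/-- **Class `2` on states**: for coincident realised states `x, y, w` (each copy with `f` open),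
the three placements of the closed copy sum to the all-isolated kernel minus the RELABELING kernel
`D = 1_Q(x) 1_Q(y) 1_Q(w) · (u_o(x) σ_o(w) σ_b(w) − u_o(y) σ_o(w) σ_b(w) − u_o(x) u_o(w) u_b(w) + u_o(y) u_b(y) u_o(w))`
(a difference of two kernels and their copy permutations, `typedCount_DK`). -/
theorem KB_pendant_a3_at_o_two (x y w : St) (hx : x.Lo = x.L3 ∧ x.Ho = x.H3)
    (hy : y.Lo = y.L3 ∧ y.Ho = y.H3) (hw : w.Lo = w.L3 ∧ w.Ho = w.H3)
    (rx : x.q' = false → ¬ (x.Lo = true ∧ x.Ho = true))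
    (ry : y.q' = false → ¬ (y.Lo = true ∧ y.Ho = true))
    (rw' : w.q' = false → ¬ (w.Lo = true ∧ w.Ho = true)) :
    KB (kill3 x) y w + KB x (kill3 y) w + KB x y (kill3 w) =
      KB (kill3 x) (kill3 y) (kill3 w) - qB x * qB y * qB w *
        (uB x.Lo x.Ho * sigB w.Lo w.Ho * sigB w.Lb w.Hb - uB y.Lo y.Ho * sigB w.Lo w.Ho * sigB w.Lb w.Hb
          - uB x.Lo x.Ho * uB w.Lo w.Ho * uB w.Lb w.Hb + uB y.Lo y.Ho * uB y.Lb y.Hb * uB w.Lo w.Ho) := by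
  have hEx := qB_mul_nB_of_real x rx
  have hEy := qB_mul_nB_of_real y ry
  have hIx := qB_mul_nB_mul_uB x
  have hIy := qB_mul_nB_mul_uB y
  have hIw := qB_mul_nB_mul_uB w
  have hJw := sigB_mul_uB w.Lo w.Ho
  have _hEw := qB_mul_nB_of_real w rw'
  simp only [KB, pdB_kill3, qB_kill3, kill3_Lo, kill3_Ho, kill3_Lb, kill3_Hb, kill3_L3,
    kill3_H3, sigB_ff, pdB_coinc x hx, pdB_coinc y hy, pdB_coinc w hw, ← hw.1, ← hw.2]
  set qx := qB x with hqx
  set qy := qB y with hqy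
  set qw := qB w with hqw
  set nx : ℤ := (if x.Lo || x.Ho then 0 else 1) with hnx
  set ny : ℤ := (if y.Lo || y.Ho then 0 else 1) with hny
  set nw : ℤ := (if w.Lo || w.Ho then 0 else 1) with hnw
  set ux := uB x.Lo x.Ho with hux
  set uy := uB y.Lo y.Ho with huy
  set uw := uB w.Lo w.Ho with huw
  set sw := sigB w.Lo w.Ho with hsw
  set ty := sigB y.Lb y.Hb with hty
  set tw := sigB w.Lb w.Hb with htw
  set vy := uB y.Lb y.Hb with hvy
  set vw := uB w.Lb w.Hb with hvw
  linear_combination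
    ((2) * qy * qw * sw * tw + (-1) * qy * qw * uw * vw + (-1) * qy * qw * uw * sw * tw
      + (-1) * qy * qw * nw * uw * vw + (-2) * qy * ty * qw * sw + qy * ty * qw * uw * sw) * hEx
    + (qx * vy * qw * uw + qx * vy * qw * nw * uw) * hEy
    + ((-2) * qx * qy * vw + (2) * qx * qy * vy + (-1) * qx * qy * uy * vy + qx * ux * qy * vw) * hIw
    + ((-1) * qy * ty * qw * sw) * hIx
    + (qx * qw * sw * tw) * hIy
    + ((-2) * qx * qy * qw * tw + (2) * qx * qy * ty * qw + qx * ux * qy * qw * tw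
      + (-1) * qx * ux * qy * ty * qw) * hJw

/-- **Class `1` on states**: the three placements of the open copy sum to twice the all-isolated
kernel minus the relabeling kernel `D` of `KB_pendant_a3_at_o_two`. -/
theorem KB_pendant_a3_at_o_one (x y w : St) (hx : x.Lo = x.L3 ∧ x.Ho = x.H3)
    (hy : y.Lo = y.L3 ∧ y.Ho = y.H3) (hw : w.Lo = w.L3 ∧ w.Ho = w.H3)
    (rx : x.q' = false → ¬ (x.Lo = true ∧ x.Ho = true))
    (ry : y.q' = false → ¬ (y.Lo = true ∧ y.Ho = true))
    (rw' : w.q' = false → ¬ (w.Lo = true ∧ w.Ho = true)) :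
    KB x (kill3 y) (kill3 w) + KB (kill3 x) y (kill3 w) + KB (kill3 x) (kill3 y) w =
      KB (kill3 x) (kill3 y) (kill3 w) + KB (kill3 x) (kill3 y) (kill3 w) - qB x * qB y * qB w *
        (uB x.Lo x.Ho * sigB w.Lo w.Ho * sigB w.Lb w.Hb - uB y.Lo y.Ho * sigB w.Lo w.Ho * sigB w.Lb w.Hb
          - uB x.Lo x.Ho * uB w.Lo w.Ho * uB w.Lb w.Hb + uB y.Lo y.Ho * uB y.Lb y.Hb * uB w.Lo w.Ho) := by
  have hEx := qB_mul_nB_of_real x rx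
  have hEy := qB_mul_nB_of_real y ry
  have hIw := qB_mul_nB_mul_uB w
  have hJw := sigB_mul_uB w.Lo w.Ho
  have _hEw := qB_mul_nB_of_real w rw'
  simp only [KB, pdB_kill3, qB_kill3, kill3_Lo, kill3_Ho, kill3_Lb, kill3_Hb, kill3_L3,
    kill3_H3, sigB_ff, pdB_coinc x hx, pdB_coinc y hy, pdB_coinc w hw, ← hw.1, ← hw.2]
  set qx := qB x with hqx
  set qy := qB y with hqy
  set qw := qB w with hqw
  set nx : ℤ := (if x.Lo || x.Ho then 0 else 1) with hnx
  set ny : ℤ := (if y.Lo || y.Ho then 0 else 1) with hny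
  set nw : ℤ := (if w.Lo || w.Ho then 0 else 1) with hnw
  set ux := uB x.Lo x.Ho with hux
  set uy := uB y.Lo y.Ho with huy
  set uw := uB w.Lo w.Ho with huw
  set sw := sigB w.Lo w.Ho with hsw
  set ty := sigB y.Lb y.Hb with hty
  set tw := sigB w.Lb w.Hb with htw
  set vy := uB y.Lb y.Hb with hvy
  set vw := uB w.Lb w.Hb with hvw
  linear_combination
    (qy * qw * sw * tw + (-1) * qy * qw * uw * vw + (-1) * qy * ty * qw * sw) * hEx
    + (qx * vy * qw * uw) * hEy
    + ((-1) * qx * qy * vw + qx * qy * vy) * hIw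
    + ((-1) * qx * qy * qw * tw + qx * qy * ty * qw) * hJw

end States

/-! ## The typed count of the relabeling kernel vanishes -/

section Relabel

variable {E : Type*} [Fintype E] [DecidableEq E] {R : Type*} [Field R]

/-- The typed count of the relabeling kernel `D` composed with any state map vanishes:
`D = A − A ∘ (12) − B + B ∘ (132)` and the typed count is invariant under the copy permutations. -/
theorem typedCount_DK (F : Finset E) (z : Config E) (τ : E → ℕ) (S : Config E → St) :
    typedCount F z τ (fun x y w => ((qB (S x) * qB (S y) * qB (S w) *
        (uB (S x).Lo (S x).Ho * sigB (S w).Lo (S w).Ho * sigB (S w).Lb (S w).Hb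
          - uB (S y).Lo (S y).Ho * sigB (S w).Lo (S w).Ho * sigB (S w).Lb (S w).Hb
          - uB (S x).Lo (S x).Ho * uB (S w).Lo (S w).Ho * uB (S w).Lb (S w).Hb
          + uB (S y).Lo (S y).Ho * uB (S y).Lb (S y).Hb * uB (S w).Lo (S w).Ho) : ℤ) : R)) = 0 := by
  set A : Config E → Config E → Config E → R := fun x y w =>
    ((qB (S x) * qB (S y) * qB (S w) *
      (uB (S x).Lo (S x).Ho * sigB (S w).Lo (S w).Ho * sigB (S w).Lb (S w).Hb) : ℤ) : R) with hA
  set B : Config E → Config E → Config E → R := fun x y w =>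
    ((qB (S x) * qB (S y) * qB (S w) *
      (uB (S x).Lo (S x).Ho * uB (S w).Lo (S w).Ho * uB (S w).Lb (S w).Hb) : ℤ) : R) with hB
  have h : ∀ x y w : Config E, ((qB (S x) * qB (S y) * qB (S w) *
        (uB (S x).Lo (S x).Ho * sigB (S w).Lo (S w).Ho * sigB (S w).Lb (S w).Hb
          - uB (S y).Lo (S y).Ho * sigB (S w).Lo (S w).Ho * sigB (S w).Lb (S w).Hb
          - uB (S x).Lo (S x).Ho * uB (S w).Lo (S w).Ho * uB (S w).Lb (S w).Hb
          + uB (S y).Lo (S y).Ho * uB (S y).Lb (S y).Hb * uB (S w).Lo (S w).Ho) : ℤ) : R) =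
      A x y w + -(A y x w) + -(B x y w) + B w x y := by
    intro x y w
    simp only [hA, hB]
    push_cast
    ring
  rw [typedCount_congr_K _ _ _ h, typedCount_add, typedCount_add, typedCount_add,
    TypedA3.typedCount_neg', TypedA3.typedCount_neg', TypedA3.typedCount_swap12 F z τ A]
  have hB' : typedCount F z τ (fun x y w => B w x y) = typedCount F z τ B := by
    have e1 := TypedA3.typedCount_swap12 F z τ (fun x y w => B w y x)
    have e2 := typedCount_swap13' F z τ B
    exact e1.trans e2
  rw [hB']
  ring

end Relabel

/-! ## The theorem -/

section Main

open Classical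

variable {V : Type*} {E : Type*} [Fintype E] [DecidableEq E] {R : Type*} [Field R]
variable (ends : E → Sym2 V) (o a₁ a₂ a₃ b : V)

omit [Fintype E] [DecidableEq E] in
/-- A realised state: under `Q` the mark `o` lies in at most one root cluster. -/
lemma st_real (ω : Config E) :
    (st ends o a₁ a₂ a₃ b ω).q' = false →
      ¬ ((st ends o a₁ a₂ a₃ b ω).Lo = true ∧ (st ends o a₁ a₂ a₃ b ω).Ho = true) := by
  unfold st
  simp only [St.q', St.Lo, St.Ho, decide_eq_false_iff_not, decide_eq_true_eq]
  intro h hc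
  exact h (conn_trans hc.2 (conn_symm hc.1))

/-- **The pendant `a₃` at `o`**: for a typed edge `f = {a₃, o}` whose end `a₃` is a leaf carrying
exactly the mark `a₃` (distinct from `o, a₁, a₂, b`), the typed base with `f` of class `k` is
`C(2, k)` times the base with `f` of class `0` (`a₃` isolated in every copy) — on every finite
graph, every pinning `z` and every type vector `τ`: `(N₀, N₁, N₂, N₃) = (N₀, 2N₀, N₀, 0)`. -/
theorem typedCount_pendant_a3_at_o {f : E} (hf : ends f = s(a₃, o))
    (hleaf : ∀ e, a₃ ∈ ends e → e = f) (h3o : a₃ ≠ o) (h31 : a₃ ≠ a₁) (h32 : a₃ ≠ a₂)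
    (h3b : a₃ ≠ b) (F : Finset E) (hfF : f ∈ F) (z : Config E) (τ : E → ℕ) (k : ℕ) :
    typedCount F z (Function.update τ f k)
        (K3 ends o a₁ a₂ a₃ b : Config E → Config E → Config E → R) =
      (Nat.choose 2 k : R) * typedCount F z (Function.update τ f 0) (K3 ends o a₁ a₂ a₃ b) := by
  set S := st ends o a₁ a₂ a₃ b with hS
  have hst : ∀ x : Config E, S (Function.update x f false) =
      kill3 (S (Function.update x f true)) := fun x =>
    st_update_pendant_a3 ends o a₁ a₂ a₃ b hf hleaf h3o h3o h31 h32 h3b x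
  have hco : ∀ x : Config E, (S (Function.update x f true)).Lo = (S (Function.update x f true)).L3 ∧
      (S (Function.update x f true)).Ho = (S (Function.update x f true)).H3 := fun x =>
    st_coinc_of_open ends o a₁ a₂ a₃ b (hf.trans Sym2.eq_swap) _ (Function.update_self f true x)
  have hre : ∀ x : Config E, (S x).q' = false → ¬ ((S x).Lo = true ∧ (S x).Ho = true) :=
    st_real ends o a₁ a₂ a₃ b
  match k with
  | 0 =>
    -- class `0`
    simp
  | 1 =>
    -- class `1`
    rw [typedCount_split_one F f hfF, typedCount_split_zero F f hfF]
    have key : ∀ x y w : Config E,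
        (K3 ends o a₁ a₂ a₃ b (Function.update x f true) (Function.update y f false)
            (Function.update w f false) : R) +
          K3 ends o a₁ a₂ a₃ b (Function.update x f false) (Function.update y f true)
            (Function.update w f false) +
          K3 ends o a₁ a₂ a₃ b (Function.update x f false) (Function.update y f false)
            (Function.update w f true) =
        (K3 ends o a₁ a₂ a₃ b (Function.update x f false) (Function.update y f false)
            (Function.update w f false) +
          K3 ends o a₁ a₂ a₃ b (Function.update x f false) (Function.update y f false)
            (Function.update w f false)) +
          -((qB (S (Function.update x f true)) * qB (S (Function.update y f true)) *
            qB (S (Function.update w f true)) *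
            (uB (S (Function.update x f true)).Lo (S (Function.update x f true)).Ho *
                sigB (S (Function.update w f true)).Lo (S (Function.update w f true)).Ho *
                sigB (S (Function.update w f true)).Lb (S (Function.update w f true)).Hb
              - uB (S (Function.update y f true)).Lo (S (Function.update y f true)).Ho *
                sigB (S (Function.update w f true)).Lo (S (Function.update w f true)).Ho *
                sigB (S (Function.update w f true)).Lb (S (Function.update w f true)).Hb
              - uB (S (Function.update x f true)).Lo (S (Function.update x f true)).Ho *
                uB (S (Function.update w f true)).Lo (S (Function.update w f true)).Ho *
                uB (S (Function.update w f true)).Lb (S (Function.update w f true)).Hb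
              + uB (S (Function.update y f true)).Lo (S (Function.update y f true)).Ho *
                uB (S (Function.update y f true)).Lb (S (Function.update y f true)).Hb *
                uB (S (Function.update w f true)).Lo (S (Function.update w f true)).Ho) : ℤ) : R) := by
      intro x y w
      simp only [K3_eq_KB, ← hS, hst]
      have h := congrArg (Int.cast : ℤ → R) (KB_pendant_a3_at_o_one _ _ _ (hco x) (hco y) (hco w)
        (hre _) (hre _) (hre _))
      push_cast at h ⊢
      linear_combination h
    rw [← typedCount_add, ← typedCount_add, typedCount_congr_K _ _ _ key, typedCount_add,
      typedCount_add, TypedA3.typedCount_neg', typedCount_DK]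
    simp only [Nat.choose_one_right, Nat.cast_ofNat]
    ring
  | 2 =>
    -- class `2`
    rw [typedCount_split_two F f hfF, typedCount_split_zero F f hfF]
    have key : ∀ x y w : Config E,
        (K3 ends o a₁ a₂ a₃ b (Function.update x f false) (Function.update y f true)
            (Function.update w f true) : R) +
          K3 ends o a₁ a₂ a₃ b (Function.update x f true) (Function.update y f false)
            (Function.update w f true) +
          K3 ends o a₁ a₂ a₃ b (Function.update x f true) (Function.update y f true)
            (Function.update w f false) =
        K3 ends o a₁ a₂ a₃ b (Function.update x f false) (Function.update y f false)
            (Function.update w f false) +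
          -((qB (S (Function.update x f true)) * qB (S (Function.update y f true)) *
            qB (S (Function.update w f true)) *
            (uB (S (Function.update x f true)).Lo (S (Function.update x f true)).Ho *
                sigB (S (Function.update w f true)).Lo (S (Function.update w f true)).Ho *
                sigB (S (Function.update w f true)).Lb (S (Function.update w f true)).Hb
              - uB (S (Function.update y f true)).Lo (S (Function.update y f true)).Ho *
                sigB (S (Function.update w f true)).Lo (S (Function.update w f true)).Ho *
                sigB (S (Function.update w f true)).Lb (S (Function.update w f true)).Hb
              - uB (S (Function.update x f true)).Lo (S (Function.update x f true)).Ho *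
                uB (S (Function.update w f true)).Lo (S (Function.update w f true)).Ho *
                uB (S (Function.update w f true)).Lb (S (Function.update w f true)).Hb
              + uB (S (Function.update y f true)).Lo (S (Function.update y f true)).Ho *
                uB (S (Function.update y f true)).Lb (S (Function.update y f true)).Hb *
                uB (S (Function.update w f true)).Lo (S (Function.update w f true)).Ho) : ℤ) : R) := by
      intro x y w
      simp only [K3_eq_KB, ← hS, hst]
      have h := congrArg (Int.cast : ℤ → R) (KB_pendant_a3_at_o_two _ _ _ (hco x) (hco y) (hco w)
        (hre _) (hre _) (hre _))
      push_cast at h ⊢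
      linear_combination h
    rw [← typedCount_add, ← typedCount_add, typedCount_congr_K _ _ _ key, typedCount_add,
      TypedA3.typedCount_neg', typedCount_DK]
    simp only [Nat.choose_self, Nat.cast_one]
    ring
  | 3 =>
    -- class `3`: the `o = a₃` coincidence in every copy
    rw [typedCount_split_three F f hfF, Nat.choose_eq_zero_of_lt (by norm_num), Nat.cast_zero,
      zero_mul]
    have h0 : ∀ x y w : Config E, (K3 ends o a₁ a₂ a₃ b (Function.update x f true)
        (Function.update y f true) (Function.update w f true) : R) = 0 := by
      intro x y w
      simp only [K3_eq_KB, ← hS]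
      rw [TypedA3.KB_eq_zero_of_o_eq_a3 _ _ _ (hco x) (hco y) (hco w)]
      simp
    rw [typedCount_congr_K _ _ _ h0]
    unfold typedCount
    simp
  | k + 4 =>
    -- class `≥ 4`: no placement
    rw [typedCount_split F f hfF, Nat.choose_eq_zero_of_lt (by omega), Nat.cast_zero, zero_mul]
    refine Finset.sum_eq_zero fun a _ => Finset.sum_eq_zero fun b _ =>
      Finset.sum_eq_zero fun c _ => ?_
    rw [Function.update_self, if_neg]
    have ha := Bool.toNat_le a
    have hb := Bool.toNat_le b
    have hc := Bool.toNat_le c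
    omega

variable [LinearOrder R] [IsStrictOrderedRing R]

/-- **Row 2′TRI at a pendant `a₃` at `o` reduces to the `a₃`-inactive base**: if the base with
`a₃` isolated is nonnegative, so is every class of the pendant instance. -/
theorem typedCount_nonneg_pendant_a3_at_o {f : E} (hf : ends f = s(a₃, o))
    (hleaf : ∀ e, a₃ ∈ ends e → e = f) (h3o : a₃ ≠ o) (h31 : a₃ ≠ a₁) (h32 : a₃ ≠ a₂)
    (h3b : a₃ ≠ b) (F : Finset E) (hfF : f ∈ F) (z : Config E) (τ : E → ℕ) (k : ℕ)
    (h0 : 0 ≤ typedCount F z (Function.update τ f 0)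
        (K3 ends o a₁ a₂ a₃ b : Config E → Config E → Config E → R)) :
    0 ≤ typedCount F z (Function.update τ f k)
        (K3 ends o a₁ a₂ a₃ b : Config E → Config E → Config E → R) := by
  rw [typedCount_pendant_a3_at_o ends o a₁ a₂ a₃ b hf hleaf h3o h31 h32 h3b F hfF z τ k]
  exact mul_nonneg (Nat.cast_nonneg _) h0

end Main

end TypedRed

end CovForm

end Summit.Ventures.PercRepro2
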